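import Summits.BirchSwinnertonDyer.BirchSwinnertonDyer.Theorems.CyclotomicUntwistPSRankOneUpperHalfAtThreeNonTower
import Summits.BirchSwinnertonDyer.BirchSwinnertonDyer.Theorems.CyclotomicUntwistPSRankOneUpperHalfAtThreeOfSOED
import Literature.NumberTheory.EllipticCurves.Kato2004.Condition1252
import HarnessLib

/-!
# K2 `PSRankOneUpperHalfAtThree` BY NAME from SOED's TOWER-FREE Kolyvagin crux Ko′ and the rank-zero leaf Z
# — the non-tower residual NT is NOT needed on the principal-series rows (the tower is automatic there)

Cell `pub/bsd-wall` (D-0145 line `route-BirchSwinnertonDyer-CyclotomicUntwist`), seat `bsd-line-cycu-p4`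
(width seat 4, gen 3). Helper toward crux K2 `PSRankOneUpperHalfAtThree` (stmt-BirchSwinnertonDyer-21581).
THEOREMS ONLY (no definition, no named fact, no `sorry`); every crux named is an ANTECEDENT; BSD is not proved
by this file and no crux is.

cycu-p3 g0's cross-route kernel (`CyclotomicUntwistPSRankOneUpperHalfAtThreeOfSOED.lean`, p-id in that file)
reads K2 ⟸ SOED{published inputs, Ko (stmt-20480, WITH the `3`-adic tower binder), Z (20387), NT (20484)}:
Ko pays the tower-surjective PS rows, NT the others. Two things have changed since:
(1) SOED rev 12–14 replaced Ko by the TOWER-FREE crux of record **Ko′ `WildKolyvaginUpperAtThreeTowerFree`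
(stmt-BirchSwinnertonDyer-24696)** and ABSORBED NT; (2) `CyclotomicUntwistPSRankOneUpperHalfAtThreeNonTower.lean`
(this seat, p600944) proves that on every principal-series row (`Addv W 3`, `Surj W 3`, `v₃(Δ_min)` even) the
`3`-adic tower HOLDS. Hence, with no non-tower input at all:

* §1 `towerSurjThree_of_addv_of_surj_of_even` — SOED's binder `AdditiveThree.TowerSurjThree W` on the cyclic
  rows from surj(3); `imageContainsSL2_three_of_addv_of_surj_of_even` — Kato's (12.5.2) for `T₃E` there
  (the Euler-system big-image hypothesis of every Kato-divisibility road at `3`, e.g. K2's alternative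
  «Kato's divisibility read through the 3-adic Gross–Zagier formula»), from surj(3) alone;
  `towerSurj_three_iff_surj_of_addv_of_even` / `towerSurjThree_iff_surj_of_addv_of_even` — on the even rows
  the tower binder of K9 / Kim@3 / SOED IS the census bit surj(3).
* §2 **`psRankOneUpperHalfAtThree_of_ko_of_rankZeroLeaf : PublishedInputsWildThree → Ko → Z → K2`** (NT dropped
  from cycu-p3's road) and **`psRankOneUpperHalfAtThree_of_koTowerFree_of_rankZeroLeaf : PublishedInputsWildThree →
  Ko′ → Z → K2`** (re-keyed to SOED's crux of record; `wildKolyvaginUpperAtThree_of_towerFree : Ko′ → Ko` is the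
  one-line weakening); the registered K2 stub `stub_upperHalf_tower` in its own binders modulo
  {published inputs, Ko′, Z} (`stub_upperHalf_tower_of_koTowerFree`).

HONEST READING: as typed, K2 = (SOED's Ko′ ∧ Z restricted to the PS rows) modulo print; the CU-specific
content K2 could add is only a DIFFERENT supply for the same socket. BSD is not proved by any of this.

References: [Kolyvagin1990] Thm. A; [Jetchev2008] Thm. 1.4; [McCallumLMS1991] §5; [Kato2004Asterisque] (12.5.2)
in Thm. 12.5 (4) (p. 222); [SerreAbelianLadic1968] IV-23 Lemma 3; [GrossZagier1986] Thm. I.(6.3).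
-/

noncomputable section

open scoped Classical

-- single-conjunct summit: `Summit.BirchSwinnertonDyer.BirchSwinnertonDyer.…` repeats the name by design
set_option linter.dupNamespace false
set_option autoImplicit false

namespace Summit.BirchSwinnertonDyer.BirchSwinnertonDyer.Theorems.PSUpperHalfOfKoTowerFree

open WeierstrassCurve Literature.NumberTheory.EllipticCurves
  Literature.NumberTheory.EllipticCurves.ModularForms
  Literature.NumberTheory.EllipticCurves.Rank1Residual
  Literature.NumberTheory.EllipticCurves.Rank1Residual.Typed
  Summit.BirchSwinnertonDyer.Rank1Residual
  Summit.BirchSwinnertonDyer.Rank1Residual.Additive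
  Summit.BirchSwinnertonDyer.BirchSwinnertonDyer.Theses.SemiOrdinaryEisensteinDescent
  Summit.BirchSwinnertonDyer.BirchSwinnertonDyer.Theorems

/-! ### §1 SOED's tower binder and Kato's (12.5.2) on the cyclic rows, from surj(3) -/

/-- **SOED's binder `TowerSurjThree W` (all levels `3ⁿ`, `n ≥ 1`) on the even rows from surj(3)** —
`PSTowerOfEven.towerSurj_three_of_addv_of_surj_of_even` in the `AdditiveThree` spelling.
[cite: SerreAbelianLadic1968, Ch. IV §3.4, Lemma 3 (IV-23)] [cite: GrossLMS1991, §1 (B(E))] -/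
theorem towerSurjThree_of_addv_of_surj_of_even (W : WeierstrassCurve ℚ) [W.IsElliptic] [W.IsGloballyMinimal]
    [Fact (Nat.Prime 3)] (hadd : Addv W 3) (hsurj : Surj W 3)
    (hev : Even (padicValInt 3 W.minimalDiscriminantInt)) : AdditiveThree.TowerSurjThree W :=
  (CyclotomicUntwistOfSOED.forall_hasSurjectiveModNGaloisRep_pow_three_iff_towerSurjThree W).mp
    (PSTowerOfEven.towerSurj_three_of_addv_of_surj_of_even W hadd hsurj hev)

/-- **Kato's (12.5.2) for `T₃E` on the even rows from surj(3)**: the image of `Gal(ℚ̄/ℚ(ζ_{3^∞}))` in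
`GL₂(ℤ₃)` contains `SL₂(ℤ₃)` — the big-image hypothesis of Kato's Thm. 12.5 (4) / 17.4 (3) at `p = 3`
holds on every principal-series / cyclic wild row with `ρ̄_{E,3}` onto (tree:
`imageContainsSL2_of_forall_hasSurjectiveModNGaloisRep` over §1 of the non-tower file).
[cite: Kato2004Asterisque, (12.5.2) in Thm. 12.5 (4) (p. 222)] [cite: SerreAbelianLadic1968, Ch. IV §3.4, Lemma 3 (IV-23)] -/
theorem imageContainsSL2_three_of_addv_of_surj_of_even (W : WeierstrassCurve ℚ) [W.IsElliptic]
    [W.IsGloballyMinimal] [Fact (Nat.Prime 3)] (hadd : Addv W 3) (hsurj : Surj W 3)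
    (hev : Even (padicValInt 3 W.minimalDiscriminantInt)) : Kato2004.ImageContainsSL2 W 3 :=
  Kato2004.imageContainsSL2_of_forall_hasSurjectiveModNGaloisRep W 3
    (PSTowerOfEven.towerSurj_three_of_addv_of_surj_of_even W hadd hsurj hev)

/-- **On the even rows the `3`-adic tower IS the census bit surj(3)**: for a globally minimal `E/ℚ`
additive at `3` with `v₃(Δ_min)` even, `(∀ n, ρ̄_{E,3ⁿ} onto) ↔ ρ̄_{E,3} onto` (⟸ is the non-tower file's
theorem, ⟹ is the level `n = 1`). For the routes that quantify over the wild cell with `E[3]` IRREDUCIBLE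
only (K9 `KatoDescentPotSupersingular`, Kim@3): on their cyclic rows the tower binder may be replaced by surj(3).
[cite: SerreAbelianLadic1968, Ch. IV §3.4, Lemma 3 (IV-23)] [cite: Wuthrich2014, Lemma 20 (p. 399)] -/
theorem towerSurj_three_iff_surj_of_addv_of_even (W : WeierstrassCurve ℚ) [W.IsElliptic] [W.IsGloballyMinimal]
    [Fact (Nat.Prime 3)] (hadd : Addv W 3) (hev : Even (padicValInt 3 W.minimalDiscriminantInt)) :
    (∀ n : ℕ, W.HasSurjectiveModNGaloisRep (3 ^ n : ℕ)) ↔ Surj W 3 :=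
  ⟨fun h ↦ by simpa [Surj] using h 1, fun hs ↦ PSTowerOfEven.towerSurj_three_of_addv_of_surj_of_even W hadd hs hev⟩

/-- The same with SOED's binder `AdditiveThree.TowerSurjThree W` (`n ≥ 1`). [cite: GrossLMS1991, §1 (B(E))]
[cite: SerreAbelianLadic1968, Ch. IV §3.4, Lemma 3 (IV-23)] -/
theorem towerSurjThree_iff_surj_of_addv_of_even (W : WeierstrassCurve ℚ) [W.IsElliptic] [W.IsGloballyMinimal]
    [Fact (Nat.Prime 3)] (hadd : Addv W 3) (hev : Even (padicValInt 3 W.minimalDiscriminantInt)) :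
    AdditiveThree.TowerSurjThree W ↔ Surj W 3 := by
  rw [← CyclotomicUntwistOfSOED.forall_hasSurjectiveModNGaloisRep_pow_three_iff_towerSurjThree W]
  exact towerSurj_three_iff_surj_of_addv_of_even W hadd hev

/-! ### §2 K2 from Ko (or the tower-free Ko′) and Z — no non-tower residual -/

/-- **Ko′ ⟹ Ko**: SOED's tower-free Kolyvagin crux (stmt-24696) implies the tower-binder form Ko
(stmt-20480) by ignoring the binder. [folklore] -/
theorem wildKolyvaginUpperAtThree_of_towerFree (hKo' : WildKolyvaginUpperAtThreeTowerFree) :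
    WildKolyvaginUpperAtThree :=
  fun W _ _ N _ K _ _ Dt H ι P hO6 hs hr hN hK hH hL hP hnt hodd hd3 _ ↦
    hKo' W N K Dt H ι P hO6 hs hr hN hK hH hL hP hnt hodd hd3

/-- **K2 BY NAME from SOED's published inputs ∧ Ko ∧ Z — NO non-tower residual.** On every row of K2
(`ClassO6 W 3`, `ρ̄_{E,3}` onto, `v₃(Δ_min)` even, `r_an = 1`) the `3`-adic tower holds
(`PSTowerOfEven`), so cycu-p3's tower-row road `upperHalf_towerRows_of_kolyvaginCrux_of_rankZeroLeaf`
(parity + Friedberg–Hoffstein Heegner field, Gross–Zagier non-torsion, Ko's co-STEP L, the joint upper half,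
Z on the twist) pays ALL rows. CONDITIONAL; closes nothing. [cite: JetchevSkinnerWan2017, §7.4.1 (arXiv:1512.06894 p. 30)]
[cite: GrossZagier1986, Thm. I.(6.3) and (7.3)] [cite: FriedbergHoffstein1995, Thm. B] [cite: Jetchev2008, Thm. 1.4] -/
theorem psRankOneUpperHalfAtThree_of_ko_of_rankZeroLeaf (hF : PublishedInputsWildThree)
    (hKoly : WildKolyvaginUpperAtThree) (hZ : WildRankZeroTwistAtThree) :
    Summit.BirchSwinnertonDyer.BirchSwinnertonDyer.Theses.CyclotomicUntwist.PSRankOneUpperHalfAtThree := by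
  intro W _ _ _hncm hO6 hsurj hev _hsq hr
  haveI : Fact (Nat.Prime 3) := ⟨Nat.prime_three⟩
  exact CyclotomicUntwistOfSOED.upperHalf_towerRows_of_kolyvaginCrux_of_rankZeroLeaf hF hKoly hZ W hO6 hsurj
    (towerSurjThree_of_addv_of_surj_of_even W hO6.2.1 hsurj hev) hr

/-- **K2 BY NAME from SOED's CRUX OF RECORD Ko′ (stmt-BirchSwinnertonDyer-24696, tower-free) and Z
(stmt-20387), with the published inputs** — the re-keyed form of cycu-p3's `psRankOneUpperHalfAtThree_of_soed`
after SOED rev 14 (Ko aside, NT absorbed) and this seat's tower theorem. CONDITIONAL; closes nothing.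
[cite: McCallumLMS1991, §5 Cor. 5.6 (p. 310)] [cite: JetchevSkinnerWan2017, §7.4.1 (arXiv:1512.06894 p. 30)]
[cite: GrossZagier1986, Thm. I.(6.3) and (7.3)] -/
theorem psRankOneUpperHalfAtThree_of_koTowerFree_of_rankZeroLeaf (hF : PublishedInputsWildThree)
    (hKo' : WildKolyvaginUpperAtThreeTowerFree) (hZ : WildRankZeroTwistAtThree) :
    Summit.BirchSwinnertonDyer.BirchSwinnertonDyer.Theses.CyclotomicUntwist.PSRankOneUpperHalfAtThree :=
  psRankOneUpperHalfAtThree_of_ko_of_rankZeroLeaf hF (wildKolyvaginUpperAtThree_of_towerFree hKo') hZ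

/-- **The one open K2 stub `stub_upperHalf_tower` (line `birth` v2) in ITS binders, modulo SOED's published
inputs ∧ Ko′ ∧ Z** (cycu-p3's `stub_upperHalf_tower_of_soed` re-keyed to the tower-free crux; CONDITIONAL helper —
a registered stub closes only unconditionally). [cite: JetchevSkinnerWan2017, §7.4.1 (arXiv:1512.06894 p. 30)]
[cite: Jetchev2008, Thm. 1.4] -/
theorem stub_upperHalf_tower_of_koTowerFree (hF : PublishedInputsWildThree)
    (hKo' : WildKolyvaginUpperAtThreeTowerFree) (hZ : WildRankZeroTwistAtThree) :
    ∀ (W : WeierstrassCurve ℚ) [W.IsElliptic] [W.IsGloballyMinimal],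
      ¬ W.HasCM → ClassO6 W 3 → Surj W 3 → (∀ n : ℕ, W.HasSurjectiveModNGaloisRep (3 ^ n : ℕ)) →
      Even (padicValInt 3 W.minimalDiscriminantInt) →
      W.minimalDiscriminantInt / 3 ^ padicValInt 3 W.minimalDiscriminantInt % 3 = 1 →
      W.analyticRank = 1 → MissingUpperBoundAt W 3 :=
  CyclotomicUntwistOfSOED.stub_upperHalf_tower_of_soed hF (wildKolyvaginUpperAtThree_of_towerFree hKo') hZ

/-- **Summary equivalence of supplies on the PS rows**: given the published inputs and Z, SOED's Ko′ gives K2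
through the registered skeleton (`Birth.psRankOneUpperHalfAtThree_of_towerStub` of the non-tower file fed with
`stub_upperHalf_tower_of_koTowerFree`) — the same statement as `psRankOneUpperHalfAtThree_of_koTowerFree_of_rankZeroLeaf`,
routed through the line's composition. [cite: JetchevSkinnerWan2017, §7.4.1 (arXiv:1512.06894 p. 30)] -/
theorem psRankOneUpperHalfAtThree_of_koTowerFree_via_birth (hF : PublishedInputsWildThree)
    (hKo' : WildKolyvaginUpperAtThreeTowerFree) (hZ : WildRankZeroTwistAtThree) :
    Summit.BirchSwinnertonDyer.BirchSwinnertonDyer.Theses.CyclotomicUntwist.PSRankOneUpperHalfAtThree :=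
  Cruxes.PSRankOneUpperHalfAtThree.Birth.psRankOneUpperHalfAtThree_of_towerStub
    (stub_upperHalf_tower_of_koTowerFree hF hKo' hZ)

end Summit.BirchSwinnertonDyer.BirchSwinnertonDyer.Theorems.PSUpperHalfOfKoTowerFree

end
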